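import Literature.Barriers.AtomisticToContinuum.OneDimensionalHardCoreToeplitz
import Mathlib.LinearAlgebra.Lagrange
import Mathlib.LinearAlgebra.Matrix.Block
import Mathlib.Analysis.Real.Pi.Wallis
import Mathlib.NumberTheory.Harmonic.Bounds
import Mathlib.MeasureTheory.Integral.Prod
import HarnessLib

/-!
# The Girardeau gas: `c₀(N)` is of exact order `√N` (lower bound via the pure Fisher–Hartwig determinant)

`Literature/Barriers/AtomisticToContinuum` (D-0021 barrier catalogue, conjunct
`BoseEinsteinCondensation`). Companion of `OneDimensionalHardCore.lean` (statement file: the typed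
sharp law `OneDimensionalHardCoreSqrt`, `c₀(N)/√N → C > 0`) and of
`OneDimensionalHardCoreToeplitz.lean` (Lenard's Toeplitz formula `c₀(n+1) = (2π)⁻¹∫₀^{2π}R(n,t)dt`,
the Szegő–Lenard UPPER bound `c₀(N) ≤ 4e√N`, and Dyson's constant modulo the pointwise
Fisher–Hartwig asymptotics). This file proves, sorry-free, the matching LOWER bound, so that
**`λ_max = c₀(N)` is of exact order `√N`**:

  `e^{-3/4} √(N+1) ≤ c₀(N) ≤ 4e √N`  for every `N ≥ 1` and every `L > 0`
  (`oneDimensionalHardCore_sqrt_order`; printed: `c₀(N) ∼ 1.5427 √N`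
  [ForresterEtAl2003, §2.2.2], [ClaeysKrasovsky2015, §1 (LDy)]).

## The argument (all proved here)

1. **Jensen on the circular unitary ensemble** (`pureDet_sq_le_zeroMomentumOccupation`). By Heine,
   `R(n, u - s) (2π)ⁿ n! = ∫_{(-π,π]ⁿ} G_u G_s |Δ|²` with `G_u(θ) = ∏_i |e^{iθ_i} - e^{iu}|`
   (`lenardDet_mul_heineConst`), and `D_n(|1 - e^{iθ}|) (2π)ⁿ n! = ∫ G_u |Δ|²` for EVERY `u`
   (rotation invariance, `pureDet_mul_heineConst`). Integrating over `u, s ∈ [0, 2π]` (Fubini,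
   `first_moment`, `second_moment`): `2π c₀(n+1)·(2π)ⁿn!·2π = ∫ M² |Δ|²` and
   `2π D_n(|1-z|) (2π)ⁿ n! = ∫ M |Δ|²`, `M(θ) = ∫₀^{2π} G_u(θ) du`; Cauchy–Schwarz in
   `L²(|Δ|² dθ)` (`first_moment_sq_le`, with `∫|Δ|² = (2π)ⁿ n!`, `heineConst_eq_integral`) gives
   `c₀(n+1) ≥ D_n(|1 - e^{iθ}|)²`. (In CUE language: `c₀(N) = E[m²] ≥ (E m)²`, `m` the circle
   average of `|det(e^{iu} - U)|`, `E m = D_{N-1}(|1 - z|)`.)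
2. **The pure Fisher–Hartwig determinant in closed form** (Widom's pure case `α = ½`, `m = 0` of
   [DeiftItsKrasovsky2013, §6 (eq84)–(eq85)]: `D_n(|1-e^{iθ}|) = G(3/2)² n^{1/4}(1+o(1))`):
   the moments are `(|1 - e^{iθ}|)_k = 4/(π(1-4k²))` (`circleCoeff_pureSymbol`), and the monic
   orthogonal polynomials are EXPLICIT — `Φ_n(z) = ∑_j q_{n,j} z^{n-j}` with Lagrange data
   `q_{n,j} = C_n A_n(-2j) w_j` at the nodes `-2j` (`pfq`; a terminating `₂F₁(-n,½;-n-½;·)`,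
   Verblunsky coefficients `-1/(2n+3)`): the orthogonality relations are the partial-fraction
   identity `∑_j q_{n,j}/(x+2j) = C_n(A_n(x)/B_n(x) - 1)` (`pf_partialFraction`, Lagrange
   interpolation of `C_n(A_n - B_n)`) evaluated at odd integers (`pfT_eq_zero`, `pfT_self`); hence
   the triangular factorisation `L T_n = U` and
   `D_n(|1-e^{iθ}|) = ∏_{k<n} λ_k`, `λ_k = ‖Φ_k‖² = (2/π)(2k)!!(2k+2)!!/((2k+1)!!)²`
   (`det_pureMatrix`, `pureDet_eq_prod`).
3. **Wallis** (`pureLam_eq_W`, `pi_div_two_mul_le_W`): `λ_k = (4/π) W_k (k+1)/(2k+1)` with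
   Mathlib's Wallis products `W_k ↑ π/2`, and the sharp lower bound `W_k ≥ (π/2)(4k+1)/(4k+2)`
   (the sequence `W_k(4k+2)/(4k+1)` decreases to `π/2`) give `λ_k ≥ 1 + k/(2k+1)²`, so
   `log D_n ≥ ∑_{1≤k<n} 1/(4(k+2)) ≥ (log(n+2) - 3/2)/4` (harmonic vs. logarithm) and
   `D_n(|1-e^{iθ}|) ≥ e^{-3/8}(n+2)^{1/4}` (`pureDet_ge`); with 1, `c₀(N) ≥ e^{-3/4}√(N+1)`.
4. **Antipodal zeros, exactly** (`lenardDet_pi`): `|e^{iθ}-1||e^{iθ}+1| = |1-e^{2iθ}|` is the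
   decimated pure symbol, and Toeplitz determinants of decimated symbols factorise by parity
   (`toeplitzDet_decimate`, `circleCoeff_comp_two_mul`), so
   `R(n, π) = D_{⌈n/2⌉}(|1-e^{iθ}|) D_{⌊n/2⌋}(|1-e^{iθ}|)` — Lenard's exact evaluation
   [Lenard1972, (42)–(46)], Dyson's anchor `k_N = R_N(π)` [DeiftItsKrasovsky2013, Remark 8];
   in particular `R(n, π) ≥ e^{-3/4}(⌈n/2⌉+2)^{1/4}(⌊n/2⌋+2)^{1/4}` (`lenardDet_pi_ge`).

## References

* [DeiftItsKrasovsky2013] P. Deift, A. Its, I. Krasovsky, Comm. Pure Appl. Math. 66 (2013)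
  1360–1438, arXiv:1207.4990: §6 (eq74), (eq78) (pure zero-type singularity), (eq84)–(eq85)
  (Widom's theorem; `m = 0`, `α₀ = ½`: `E = G(3/2)²/G(2)`), Remark 8.
* [Widom1973] H. Widom, Amer. J. Math. 95 (1973) 333–383 (the pure case with its constant).
* [Lenard1972] A. Lenard, Pacific J. Math. 42 (1972) 137–145: (32) `D_n = ∏ (Lφ_j)^{-2}` and
  (33)–(41) (Jacobi-type weights on the circle have explicitly computable orthogonal polynomials).
* [ClaeysKrasovsky2015] T. Claeys, I. Krasovsky, Duke Math. J. 164 (2015), §1 (Heine), (Lrho0)–(LDy).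
* [ForresterEtAl2003] Forrester–Frankel–Garoni–Witte, Phys. Rev. A 67 (2003) 043607, §2.2.2.

## Design notes

No statement or definition of the statement file is changed and no named fact is introduced
(every `def` has a body; every result is a `theorem`). The auxiliary objects (`pfA`, `pfB`, `pfC`,
`pfW`, `pfq`, `pfT`, `pureEntry`, `pureMatrix`, `pureL`, `pureLam`, `pureSymbol`, `pureDet`,
`zeroFactor`, `zeroFactorMean`, `parityEquiv`) live in `Literature.Barriers.AtomisticToContinuum.BoseGas`.
-/

noncomputable section

open MeasureTheory Filter Topology Finset Complex Matrix Polynomial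
open Literature.Analysis.Toeplitz Literature.Analysis.Potential
open scoped BigOperators Real ComplexConjugate

namespace Literature.Barriers.AtomisticToContinuum.BoseGas

/-! ### Lagrange data at the nodes `-2j` -/

section PureFHAlgebra

/-- `A_n(x) = ∏_{i ≤ n} (x + 2i + 1)`. [folklore] -/
def pfA (n : ℕ) (x : ℝ) : ℝ := ∏ i ∈ range (n + 1), (x + (2 * (i : ℝ) + 1))

/-- `B_n(x) = ∏_{i ≤ n} (x + 2i)` (the nodal polynomial of the nodes `-2i`). [folklore] -/
def pfB (n : ℕ) (x : ℝ) : ℝ := ∏ i ∈ range (n + 1), (x + 2 * (i : ℝ))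

/-- `C_n = (2n)!!/(2n+1)!! = ∏_{i<n}(2i+2) / ∏_{i≤n}(2i+1)`. [folklore] -/
def pfC (n : ℕ) : ℝ := (∏ i ∈ range n, (2 * (i : ℝ) + 2)) / ∏ i ∈ range (n + 1), (2 * (i : ℝ) + 1)

/-- The Lagrange weights `w_j = ∏_{l ≤ n, l ≠ j} (2(l - j))⁻¹` at the nodes `-2j`. [folklore] -/
def pfW (n j : ℕ) : ℝ := ∏ l ∈ (range (n + 1)).erase j, (2 * ((l : ℝ) - j))⁻¹

/-- **The coefficients of the monic orthogonal polynomials** for the weight `|1 - e^{iθ}|`: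
`Φ_n(z) = ∑_{j ≤ n} q_{n,j} z^{n-j}` with `q_{n,j} = C_n A_n(-2j) w_j`
(`= binom(n,j) ∏_{i<j} (2i+1)/(2n+1-2i)`, a terminating `₂F₁(-n, ½; -n-½; ·)`). [folklore] -/
def pfq (n j : ℕ) : ℝ := pfC n * pfA n (-(2 * (j : ℝ))) * pfW n j

/-- `A_n(x) > 0` for `x ≥ 0`. [folklore] -/
theorem pfA_pos (n : ℕ) {x : ℝ} (hx : 0 ≤ x) : 0 < pfA n x := by
  unfold pfA
  exact prod_pos fun i _ => by positivity

/-- `B_n(1) > 0`. [folklore] -/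
theorem pfB_one_pos (n : ℕ) : 0 < pfB n 1 := by
  unfold pfB
  exact prod_pos fun i _ => by positivity

/-- `C_n > 0`. [folklore] -/
theorem pfC_pos (n : ℕ) : 0 < pfC n := by
  unfold pfC
  exact div_pos (prod_pos fun i _ => by positivity) (prod_pos fun i _ => by positivity)

/-- `q_{n,0} = 1` (the polynomials are monic). [folklore] -/
theorem pfq_zero (n : ℕ) : pfq n 0 = 1 := by
  have hW : pfW n 0 = (∏ i ∈ range n, (2 * (i : ℝ) + 2))⁻¹ := by
    unfold pfW
    have hset : (range (n + 1)).erase 0 = (range n).image (fun i => i + 1) := by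
      ext x
      simp only [mem_erase, mem_range, mem_image]
      constructor
      · rintro ⟨hx0, hx⟩
        exact ⟨x - 1, by omega, by omega⟩
      · rintro ⟨a, ha, rfl⟩
        exact ⟨by omega, by omega⟩
    rw [hset, prod_image (fun a _ b _ h => by simpa using h), ← prod_inv_distrib]
    refine prod_congr rfl fun i _ => ?_
    push_cast
    ring
  have hA : pfA n (-(2 * ((0 : ℕ) : ℝ))) = ∏ i ∈ range (n + 1), (2 * (i : ℝ) + 1) := by
    unfold pfA
    refine prod_congr rfl fun i _ => ?_
    push_cast
    ring
  unfold pfq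
  rw [hW, hA, pfC]
  have h1 : (∏ i ∈ range (n + 1), (2 * (i : ℝ) + 1)) ≠ 0 :=
    (prod_pos fun i _ => by positivity).ne'
  have h2 : (∏ i ∈ range n, (2 * (i : ℝ) + 2)) ≠ 0 := (prod_pos fun i _ => by positivity).ne'
  field_simp

/-- `B_n(-2j) = 0` for `j ≤ n`. [folklore] -/
theorem pfB_node (n : ℕ) {j : ℕ} (hj : j ∈ range (n + 1)) : pfB n (-(2 * (j : ℝ))) = 0 := by
  unfold pfB
  exact prod_eq_zero hj (by ring)

/-- `A_n(x) = 0` when `x + 2i + 1 = 0` for some `i ≤ n`. [folklore] -/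
theorem pfA_eq_zero (n : ℕ) {x : ℝ} {i : ℕ} (hi : i ∈ range (n + 1))
    (hx : x + (2 * (i : ℝ) + 1) = 0) : pfA n x = 0 := by
  unfold pfA
  exact prod_eq_zero hi hx

/-- `B_n(x) ≠ 0` off the nodes. [folklore] -/
theorem pfB_ne_zero (n : ℕ) {x : ℝ} (hx : ∀ i ∈ range (n + 1), x + 2 * (i : ℝ) ≠ 0) :
    pfB n x ≠ 0 := by
  unfold pfB
  exact prod_ne_zero_iff.2 hx

/-- **The partial-fraction identity behind orthogonality** (Lagrange interpolation of
`C_n (A_n - B_n)`, a polynomial of degree `≤ n`, at the `n+1` nodes `-2j`):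
`∑_{j ≤ n} q_{n,j}/(x + 2j) = C_n (A_n(x)/B_n(x) - 1)` off the nodes. [folklore] -/
theorem pf_partialFraction (n : ℕ) {x : ℝ} (hx : ∀ i ∈ range (n + 1), x + 2 * (i : ℝ) ≠ 0) :
    ∑ j ∈ range (n + 1), pfq n j / (x + 2 * j) = pfC n * (pfA n x / pfB n x - 1) := by
  classical
  set s : Finset ℕ := range (n + 1) with hs
  set v : ℕ → ℝ := fun i => -(2 * (i : ℝ)) with hv
  have hvs : Set.InjOn v s := fun a _ b _ h => by
    simp only [hv] at h
    exact_mod_cast (by linarith : (a : ℝ) = b)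
  -- the polynomial `R = C_n (A - B)`
  set PA : ℝ[X] := ∏ i ∈ s, (X + Polynomial.C (2 * (i : ℝ) + 1)) with hPA
  set PB : ℝ[X] := Lagrange.nodal s v with hPB
  have hPB' : PB = ∏ i ∈ s, (X + Polynomial.C (2 * (i : ℝ))) := by
    rw [hPB, Lagrange.nodal]
    refine prod_congr rfl fun i _ => ?_
    rw [hv, sub_eq_add_neg, ← Polynomial.C_neg, neg_neg]
  have hmA : PA.Monic := monic_prod_of_monic _ _ fun i _ => monic_X_add_C _
  have hmB : PB.Monic := by rw [hPB']; exact monic_prod_of_monic _ _ fun i _ => monic_X_add_C _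
  have hdA : PA.natDegree = n + 1 := by
    rw [hPA, natDegree_prod_of_monic _ _ fun i _ => monic_X_add_C _]
    simp only [natDegree_X_add_C, sum_const, card_range, smul_eq_mul, mul_one, hs]
  have hdB : PB.natDegree = n + 1 := by
    rw [hPB', natDegree_prod_of_monic _ _ fun i _ => monic_X_add_C _]
    simp only [natDegree_X_add_C, sum_const, card_range, smul_eq_mul, mul_one, hs]
  set R : ℝ[X] := pfC n • (PA - PB) with hR
  have hdegR : R.degree < #s := by
    rw [hs, card_range]
    have hsub : (PA - PB).degree < PA.degree := by
      refine degree_sub_lt ?_ hmA.ne_zero ?_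
      · rw [degree_eq_natDegree hmA.ne_zero, degree_eq_natDegree hmB.ne_zero, hdA, hdB]
      · rw [hmA.leadingCoeff, hmB.leadingCoeff]
    rw [degree_eq_natDegree hmA.ne_zero, hdA] at hsub
    exact (degree_smul_le _ _).trans_lt (by exact_mod_cast hsub)
  -- evaluations of `R`
  have hevalA : ∀ y : ℝ, PA.eval y = pfA n y := by
    intro y
    rw [hPA, eval_prod]
    unfold pfA
    refine prod_congr rfl fun i _ => ?_
    simp
  have hevalB : ∀ y : ℝ, PB.eval y = pfB n y := by
    intro y
    rw [hPB', eval_prod]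
    unfold pfB
    refine prod_congr rfl fun i _ => ?_
    simp
  have hevalR : ∀ y : ℝ, R.eval y = pfC n * (pfA n y - pfB n y) := by
    intro y
    rw [hR, eval_smul, eval_sub, hevalA, hevalB, smul_eq_mul]
  -- Lagrange interpolation
  have hinterp := Lagrange.eq_interpolate hvs hdegR (f := R)
  have hxv : ∀ i ∈ s, x ≠ v i := by
    intro i hi h
    apply hx i hi
    rw [h, hv]
    ring
  have hev := Lagrange.eval_interpolate_not_at_node (fun i => R.eval (v i)) hxv
  rw [← hinterp, Lagrange.eval_nodal, hevalR] at hev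
  -- rewrite the right-hand side of `hev`
  have hnode : ∀ i ∈ s, R.eval (v i) = pfC n * pfA n (-(2 * (i : ℝ))) := by
    intro i hi
    rw [hevalR, hv]
    simp only
    rw [pfB_node n hi, sub_zero]
  have hW : ∀ i ∈ s, Lagrange.nodalWeight s v i = pfW n i := by
    intro i _
    unfold Lagrange.nodalWeight pfW
    refine prod_congr rfl fun l _ => ?_
    simp only [hv]
    ring
  have hprodB : ∏ i ∈ s, (x - v i) = pfB n x := by
    unfold pfB
    refine prod_congr rfl fun i _ => ?_
    simp only [hv]
    ring
  rw [hprodB] at hev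
  have hsum : ∑ i ∈ s, Lagrange.nodalWeight s v i * (x - v i)⁻¹ * R.eval (v i) =
      ∑ j ∈ s, pfq n j / (x + 2 * j) := by
    refine sum_congr rfl fun i hi => ?_
    rw [hW i hi, hnode i hi, hv]
    unfold pfq
    simp only [sub_neg_eq_add]
    ring
  rw [hsum] at hev
  -- `hev : C (A x - B x) = B x * ∑ q_j/(x+2j)`; divide by `B x ≠ 0`
  have hB0 : pfB n x ≠ 0 := pfB_ne_zero n hx
  field_simp
  linarith [hev]

/-- `A_n` vanishes at `x = 2(i - k) + 1` for `i < k ≤ n`… precisely: for integers `0 ≤ i < k`,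
`A_k(2(i-k)+1) = 0` (the factor with index `k-i-1`). [folklore] -/
theorem pfA_shift_eq_zero {k i : ℕ} (hik : i < k) : pfA k (2 * ((i : ℝ) - k) + 1) = 0 := by
  have hmem : k - i - 1 ∈ range (k + 1) := by simp only [mem_range]; omega
  refine pfA_eq_zero k hmem ?_
  have : ((k - i - 1 : ℕ) : ℝ) = (k : ℝ) - i - 1 := by
    rw [Nat.cast_sub (by omega), Nat.cast_sub hik.le]; push_cast; ring
  rw [this]; ring

/-- For integers `0 ≤ i < k`, `A_k(2(i-k)-1) = 0` (the factor with index `k-i`). [folklore] -/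
theorem pfA_shift_eq_zero' {k i : ℕ} (hik : i < k) : pfA k (2 * ((i : ℝ) - k) - 1) = 0 := by
  have hmem : k - i ∈ range (k + 1) := by simp only [mem_range]; omega
  refine pfA_eq_zero k hmem ?_
  rw [Nat.cast_sub hik.le]; ring

/-- `A_k(-1) = 0` (the factor with index `0`). [folklore] -/
theorem pfA_neg_one (k : ℕ) : pfA k (-1) = 0 :=
  pfA_eq_zero k (i := 0) (by simp) (by simp)

/-- The odd points `2(i-k) ± 1 + 2j` are never zero. [folklore] -/
theorem odd_shift_ne_zero (i k j : ℕ) (e : ℝ) (he : e = 1 ∨ e = -1) :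
    2 * ((i : ℝ) - k) + e + 2 * (j : ℝ) ≠ 0 := by
  intro h
  rcases he with rfl | rfl
  · have h2 : (2 : ℝ) * ((i : ℝ) - k + j) = -1 := by linarith
    have h3 : (2 : ℤ) * ((i : ℤ) - k + j) = -1 := by exact_mod_cast h2
    omega
  · have h2 : (2 : ℝ) * ((i : ℝ) - k + j) = 1 := by linarith
    have h3 : (2 : ℤ) * ((i : ℤ) - k + j) = 1 := by exact_mod_cast h2
    omega

/-- The **orthogonality sums** `T(k, i) = ∑_{j ≤ k} q_{k,j} / (1 - 4(i + j - k)²)`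
(`= (π/4) ⟨Φ_k, z^i⟩`). [folklore] -/
def pfT (k i : ℕ) : ℝ := ∑ j ∈ range (k + 1), pfq k j / (1 - 4 * ((i : ℝ) + j - k) ^ 2)

/-- Partial fractions: `T(k,i) = ½ (Q_k(2(i-k)+1) - Q_k(2(i-k)-1))`, `Q_k(x) = ∑ q_{k,j}/(x+2j)`.
[folklore] -/
theorem pfT_eq (k i : ℕ) :
    pfT k i = 1 / 2 * (pfC k * (pfA k (2 * ((i : ℝ) - k) + 1) / pfB k (2 * ((i : ℝ) - k) + 1) - 1) -
      pfC k * (pfA k (2 * ((i : ℝ) - k) - 1) / pfB k (2 * ((i : ℝ) - k) - 1) - 1)) := by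
  have h1 : ∀ j ∈ range (k + 1), 2 * ((i : ℝ) - k) + 1 + 2 * (j : ℝ) ≠ 0 :=
    fun j _ => odd_shift_ne_zero i k j 1 (Or.inl rfl)
  have h2 : ∀ j ∈ range (k + 1), 2 * ((i : ℝ) - k) - 1 + 2 * (j : ℝ) ≠ 0 := by
    intro j _
    have := odd_shift_ne_zero i k j (-1) (Or.inr rfl)
    rwa [← sub_eq_add_neg] at this
  rw [← pf_partialFraction k h1, ← pf_partialFraction k h2, ← sum_sub_distrib, mul_sum]
  unfold pfT
  refine sum_congr rfl fun j hj => ?_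
  have ha := h1 j hj
  have hb := h2 j hj
  have key : 1 - 4 * ((i : ℝ) + j - k) ^ 2 =
      -((2 * ((i : ℝ) - k) + 1 + 2 * j) * (2 * ((i : ℝ) - k) - 1 + 2 * j)) := by ring
  rw [key, div_neg, div_sub_div _ _ ha hb,
    show pfq k j * (2 * ((i : ℝ) - k) - 1 + 2 * j) - (2 * ((i : ℝ) - k) + 1 + 2 * j) * pfq k j =
      -2 * pfq k j by ring]
  ring

/-- **Orthogonality**: `T(k, i) = 0` for `i < k`. [folklore] -/
theorem pfT_eq_zero {k i : ℕ} (hik : i < k) : pfT k i = 0 := by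
  rw [pfT_eq, pfA_shift_eq_zero hik, pfA_shift_eq_zero' hik]
  simp

/-- **The squared norm**: `T(k, k) = C_k A_k(1) / (2 B_k(1))`. [folklore] -/
theorem pfT_self (k : ℕ) : pfT k k = pfC k * pfA k 1 / (2 * pfB k 1) := by
  rw [pfT_eq]
  simp only [sub_self, mul_zero, zero_add, zero_sub, pfA_neg_one, zero_div]
  ring

/-! ### The moment matrix and its determinant -/

/-- The entries `4/(π(1 - 4s²))` of the moment matrix of `|1 - e^{iθ}|`
(`= (2π)⁻¹∫ e^{-isθ} |1 - e^{iθ}| dθ`). [folklore] -/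
def pureEntry (s : ℤ) : ℝ := 4 / (π * (1 - 4 * (s : ℝ) ^ 2))

/-- The real Toeplitz (moment) matrix `(4/(π(1-4(j-k)²)))_{j,k<n}`. [folklore] -/
def pureMatrix (n : ℕ) : Matrix (Fin n) (Fin n) ℝ :=
  Matrix.of fun j k : Fin n => pureEntry ((j : ℤ) - k)

/-- The unit lower-triangular matrix of coefficients: row `k` lists the coefficients of `Φ_k`
(entry `(k, i)` is the coefficient `q_{k,k-i}` of `z^i`). [folklore] -/
def pureL (n : ℕ) : Matrix (Fin n) (Fin n) ℝ :=
  Matrix.of fun k i : Fin n => if (i : ℕ) ≤ k then pfq k (k - i) else 0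

/-- **The squared norms** `λ_k = ‖Φ_k‖² = (4/π) T(k,k) = (2/π) C_k A_k(1)/B_k(1)`
(`= (2/π)(2k)!!(2k+2)!!/((2k+1)!!)²`: `λ₀ = 4/π`, `λ₁ = 32/(9π)`, …). [folklore] -/
def pureLam (k : ℕ) : ℝ := 2 / π * (pfC k * pfA k 1 / pfB k 1)

/-- `(L M)_{k,i} = (4/π) T(k,i)`. [folklore] -/
theorem pureL_mul_pureMatrix (n : ℕ) (k i : Fin n) :
    (pureL n * pureMatrix n) k i = 4 / π * pfT k i := by
  classical
  rw [Matrix.mul_apply]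
  have h1 : ∑ i' : Fin n, pureL n k i' * pureMatrix n i' i =
      ∑ i' ∈ (univ : Finset (Fin n)).filter (fun i' : Fin n => (i' : ℕ) ≤ k),
        pfq k (k - i') * pureEntry ((i' : ℤ) - i) := by
    rw [Finset.sum_filter]
    refine sum_congr rfl fun i' _ => ?_
    simp only [pureL, pureMatrix, Matrix.of_apply]
    split_ifs <;> simp
  rw [h1]
  unfold pfT
  rw [mul_sum]
  refine Finset.sum_nbij' (fun i' : Fin n => (k : ℕ) - i') (fun j => (⟨k - j, by omega⟩ : Fin n))
    ?_ ?_ ?_ ?_ ?_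
  · intro i' hi'
    simp only [mem_filter, mem_univ, true_and] at hi'
    simp only [mem_range]
    omega
  · intro j hj
    simp only [mem_filter, mem_univ, true_and]
    exact Nat.sub_le _ _
  · intro i' hi'
    simp only [mem_filter, mem_univ, true_and] at hi'
    apply Fin.ext
    simp only
    omega
  · intro j hj
    simp only [mem_range] at hj
    simp only
    omega
  · intro i' hi'
    simp only [mem_filter, mem_univ, true_and] at hi'
    simp only [pureEntry]
    have hcast : (((k : ℕ) - (i' : ℕ) : ℕ) : ℝ) = (k : ℝ) - i' := Nat.cast_sub hi'
    rw [hcast]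
    have hint : ((((i' : ℕ) : ℤ) - ((i : ℕ) : ℤ) : ℤ) : ℝ) = (i' : ℝ) - i := by push_cast; ring
    rw [hint]
    have hsq : ((i' : ℝ) - i) ^ 2 = ((i : ℝ) + ((k : ℝ) - i') - k) ^ 2 := by ring
    rw [hsq, div_mul_eq_div_div]
    ring

/-- `L M` is upper triangular with diagonal `λ_k`. [folklore] -/
theorem pureL_mul_pureMatrix_apply (n : ℕ) (k i : Fin n) :
    (pureL n * pureMatrix n) k i = if (i : ℕ) < k then 0 else if i = k then pureLam k
      else (pureL n * pureMatrix n) k i := by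
  split_ifs with h1 h2
  · rw [pureL_mul_pureMatrix, pfT_eq_zero h1, mul_zero]
  · subst h2
    rw [pureL_mul_pureMatrix, pfT_self, pureLam]
    have hπ : (π : ℝ) ≠ 0 := Real.pi_ne_zero
    have hB : pfB i 1 ≠ 0 := (pfB_one_pos i).ne'
    field_simp
    ring
  · rfl

/-- `det L = 1` (unit lower triangular: `q_{k,0} = 1`). [folklore] -/
theorem det_pureL (n : ℕ) : (pureL n).det = 1 := by
  have htri : (pureL n).BlockTriangular OrderDual.toDual := by
    intro i j hij
    simp only [pureL, Matrix.of_apply]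
    have : ¬ ((j : ℕ) ≤ i) := by
      have h : i < j := hij
      exact not_le.2 (by exact_mod_cast h)
    rw [if_neg this]
  rw [Matrix.det_of_lowerTriangular _ htri]
  refine prod_eq_one fun i _ => ?_
  simp only [pureL, Matrix.of_apply, le_refl, if_true, Nat.sub_self]
  exact pfq_zero i

/-- **The pure Fisher–Hartwig determinant in closed form**:
`det (4/(π(1-4(j-k)²)))_{j,k<n} = ∏_{k<n} λ_k`. [folklore] -/
theorem det_pureMatrix (n : ℕ) : (pureMatrix n).det = ∏ k ∈ range n, pureLam k := by
  have hLM : (pureL n * pureMatrix n).det = ∏ k ∈ range n, pureLam k := by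
    have htri : (pureL n * pureMatrix n).BlockTriangular id := by
      intro i j hij
      rw [pureL_mul_pureMatrix_apply]
      have h : (j : ℕ) < i := by exact_mod_cast (hij : j < i)
      rw [if_pos h]
    rw [Matrix.det_of_upperTriangular htri]
    rw [Finset.prod_fin_eq_prod_range]
    refine prod_congr rfl fun k hk => ?_
    simp only [mem_range] at hk
    rw [dif_pos hk, pureL_mul_pureMatrix_apply]
    simp
  rw [det_mul, det_pureL, one_mul] at hLM
  exact hLM

end PureFHAlgebra

/-! ### Wallis: `λ_k = (4/π) W_k (k+1)/(2k+1) ≥ 1 + k/(2k+1)²` and `∏_{k<n} λ_k ≥ e^{-3/8}(n+2)^{1/4}` -/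

section Wallis

open Real.Wallis

/-- Recursion of `λ_k`: `λ_{k+1} = λ_k (2k+2)(2k+4)/(2k+3)²` (`= 1 - α_k²`, `α_k = -1/(2k+3)` the
Verblunsky coefficients). [folklore] -/
theorem pureLam_succ (k : ℕ) :
    pureLam (k + 1) = pureLam k * ((2 * k + 2) * (2 * k + 4) / (2 * k + 3) ^ 2) := by
  have hA : pfA (k + 1) 1 = pfA k 1 * (2 * k + 4) := by
    unfold pfA; rw [prod_range_succ]; push_cast; ring
  have hB : pfB (k + 1) 1 = pfB k 1 * (2 * k + 3) := by
    unfold pfB; rw [prod_range_succ]; push_cast; ring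
  have hC : pfC (k + 1) = pfC k * ((2 * k + 2) / (2 * k + 3)) := by
    unfold pfC
    rw [prod_range_succ, prod_range_succ _ (k + 1)]
    have h1 : (∏ i ∈ range (k + 1), (2 * (i : ℝ) + 1)) ≠ 0 :=
      (prod_pos fun i _ => by positivity).ne'
    push_cast
    field_simp
    ring
  rw [pureLam, pureLam, hA, hB, hC]
  have hB0 : pfB k 1 ≠ 0 := (pfB_one_pos k).ne'
  have hπ : (π : ℝ) ≠ 0 := Real.pi_ne_zero
  field_simp

/-- `λ₀ = 4/π`. [folklore] -/
theorem pureLam_zero : pureLam 0 = 4 / π := by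
  simp [pureLam, pfC, pfA, pfB]
  ring

/-- **`λ_k` in terms of the Wallis products**: `λ_k = (4/π) W_k (k+1)/(2k+1)`. [folklore] -/
theorem pureLam_eq_W (k : ℕ) : pureLam k = 4 / π * W k * ((k + 1) / (2 * k + 1)) := by
  induction k with
  | zero => rw [pureLam_zero]; simp [W]
  | succ k ih =>
    rw [pureLam_succ, ih, W_succ]
    push_cast
    have h1 : (2 * (k : ℝ) + 1) ≠ 0 := by positivity
    have h2 : (2 * (k : ℝ) + 3) ≠ 0 := by positivity
    have h3 : (2 * ((k : ℝ) + 1) + 1) ≠ 0 := by positivity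
    field_simp
    ring

/-- The sequence `W_k (4k+2)/(4k+1)` is decreasing (its successive ratio is
`(2k+2)²(4k+6)(4k+1)/((2k+1)(2k+3)(4k+5)(4k+2)) < 1`). [folklore] -/
theorem antitone_W_mul : Antitone fun k : ℕ => W k * ((4 * k + 2) / (4 * k + 1)) := by
  refine antitone_nat_of_succ_le fun k => ?_
  have hW := W_pos k
  rw [W_succ, mul_assoc]
  refine mul_le_mul_of_nonneg_left ?_ hW.le
  push_cast
  rw [div_mul_div_comm, div_mul_div_comm, div_le_div_iff₀ (by positivity) (by positivity)]
  have key : (4 * (k : ℝ) + 2) * ((2 * k + 1) * (2 * k + 3) * (4 * (k + 1) + 1)) -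
      (2 * k + 2) * (2 * k + 2) * (4 * (k + 1) + 2) * (4 * k + 1) = 4 * k + 6 := by ring
  nlinarith [key]

/-- **A sharp Wallis lower bound**: `W_k ≥ (π/2)(4k+1)/(4k+2)` (Mathlib's `le_W` has
`(2k+1)/(2k+2)`). [folklore] -/
theorem pi_div_two_mul_le_W (k : ℕ) : π / 2 * ((4 * k + 1) / (4 * k + 2)) ≤ W k := by
  have hlim : Tendsto (fun k : ℕ => W k * ((4 * k + 2) / (4 * k + 1))) atTop (𝓝 (π / 2)) := by
    have h1 : Tendsto (fun k : ℕ => ((4 * (k : ℝ) + 2) / (4 * k + 1))) atTop (𝓝 1) := by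
      have h : Tendsto (fun k : ℕ => 1 + 1 / (4 * (k : ℝ) + 1)) atTop (𝓝 (1 + 0)) := by
        refine tendsto_const_nhds.add ?_
        refine tendsto_const_nhds.div_atTop ?_
        exact tendsto_atTop_add_const_right _ _
          (tendsto_natCast_atTop_atTop.const_mul_atTop (by norm_num))
      rw [add_zero] at h
      refine h.congr fun k => ?_
      have : (4 * (k : ℝ) + 1) ≠ 0 := by positivity
      field_simp
      ring
    have := tendsto_W_nhds_pi_div_two.mul h1
    rwa [mul_one] at this
  have hle := antitone_W_mul.le_of_tendsto hlim k
  have hpos : (0 : ℝ) < (4 * k + 2) / (4 * k + 1) := by positivity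
  have h1 : (4 * (k : ℝ) + 1) ≠ 0 := by positivity
  have h2 : (4 * (k : ℝ) + 2) ≠ 0 := by positivity
  calc π / 2 * ((4 * k + 1) / (4 * k + 2))
      ≤ W k * ((4 * k + 2) / (4 * k + 1)) * ((4 * k + 1) / (4 * k + 2)) :=
        mul_le_mul_of_nonneg_right hle (by positivity)
    _ = W k := by field_simp

/-- **Lower bound for the squared norms**: `λ_k ≥ 1 + k/(2k+1)²` (`≈ 1 + 1/(4k)`). [folklore] -/
theorem pureLam_ge (k : ℕ) : 1 + k / (2 * k + 1) ^ 2 ≤ pureLam k := by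
  rw [pureLam_eq_W]
  have hW := pi_div_two_mul_le_W k
  have hπ := Real.pi_pos
  have h1 : (0 : ℝ) < 2 * k + 1 := by positivity
  have h2 : (0 : ℝ) < 4 * k + 2 := by positivity
  calc 1 + (k : ℝ) / (2 * k + 1) ^ 2 = 4 / π * (π / 2 * ((4 * k + 1) / (4 * k + 2))) *
        ((k + 1) / (2 * k + 1)) := by
        field_simp
        ring
    _ ≤ 4 / π * W k * ((k + 1) / (2 * k + 1)) := by gcongr

/-- `λ_k ≥ 1`. [folklore] -/
theorem one_le_pureLam (k : ℕ) : 1 ≤ pureLam k :=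
  le_trans (by simp only [le_add_iff_nonneg_right]; positivity) (pureLam_ge k)

/-- `log λ_k ≥ 1/(4(k+2))` for `k ≥ 1`. [folklore] -/
theorem log_pureLam_ge {k : ℕ} (hk : 1 ≤ k) : 1 / (4 * ((k : ℝ) + 2)) ≤ Real.log (pureLam k) := by
  have hk' : (1 : ℝ) ≤ k := by exact_mod_cast hk
  set u : ℝ := k / (2 * k + 1) ^ 2 with hu
  have hu0 : 0 < u := by positivity
  have h1 : Real.log (1 + u) ≤ Real.log (pureLam k) :=
    Real.log_le_log (by positivity) (pureLam_ge k)
  -- `log(1+u) ≥ u/(1+u)`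
  have h2 : u / (1 + u) ≤ Real.log (1 + u) := by
    have h := Real.log_le_sub_one_of_pos (x := (1 + u)⁻¹) (by positivity)
    rw [Real.log_inv] at h
    have : (1 + u)⁻¹ - 1 = -(u / (1 + u)) := by field_simp; ring
    rw [this] at h
    linarith
  have h3 : 1 / (4 * ((k : ℝ) + 2)) ≤ u / (1 + u) := by
    have : u / (1 + u) = k / ((2 * k + 1) ^ 2 + k) := by
      rw [hu]
      have : (2 * (k : ℝ) + 1) ^ 2 ≠ 0 := by positivity
      field_simp
    rw [this, div_le_div_iff₀ (by positivity) (by positivity)]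
    nlinarith
  linarith

/-- `log λ_k ≥ 1/(4(k+2)) - [k = 0]/8` for every `k`. [folklore] -/
theorem log_pureLam_ge' (k : ℕ) :
    1 / (4 * ((k : ℝ) + 2)) - (if k = 0 then 1 / 8 else 0) ≤ Real.log (pureLam k) := by
  rcases Nat.eq_zero_or_pos k with hk | hk
  · subst hk
    simp only [Nat.cast_zero, zero_add, if_true]
    have : (0 : ℝ) ≤ Real.log (pureLam 0) := Real.log_nonneg (one_le_pureLam 0)
    linarith
  · rw [if_neg (by omega), sub_zero]
    exact log_pureLam_ge hk

/-- The shifted harmonic sum dominates the logarithm: `∑_{k<n} 1/(k+2) ≥ log(n+2) - 1`.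
[folklore] -/
theorem log_sub_one_le_sum_inv (n : ℕ) :
    Real.log (n + 2) - 1 ≤ ∑ k ∈ range n, 1 / ((k : ℝ) + 2) := by
  have h := log_add_one_le_harmonic (n + 1)
  have hcast : ((harmonic (n + 1) : ℚ) : ℝ) = ∑ i ∈ range (n + 1), 1 / ((i : ℝ) + 1) := by
    simp [harmonic]
  rw [hcast, sum_range_succ'] at h
  push_cast at h
  have hsum : ∑ i ∈ range n, 1 / ((i : ℝ) + 1 + 1) = ∑ k ∈ range n, 1 / ((k : ℝ) + 2) := by
    refine sum_congr rfl fun i _ => ?_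
    ring
  rw [hsum] at h
  have h2 : Real.log ((n : ℝ) + 2) = Real.log ((n : ℝ) + 1 + 1) := by ring_nf
  rw [h2]
  norm_num at h ⊢
  linarith

/-- **The pure determinant grows like `n^{1/4}`**: `log ∏_{k<n} λ_k ≥ (log(n+2) - 3/2)/4`.
[folklore] -/
theorem log_prod_pureLam_ge (n : ℕ) :
    (Real.log (n + 2) - 3 / 2) / 4 ≤ Real.log (∏ k ∈ range n, pureLam k) := by
  rw [Real.log_prod fun k _ => (lt_of_lt_of_le one_pos (one_le_pureLam k)).ne']
  have h1 : ∑ k ∈ range n, (1 / (4 * ((k : ℝ) + 2)) - (if k = 0 then 1 / 8 else 0)) ≤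
      ∑ k ∈ range n, Real.log (pureLam k) := sum_le_sum fun k _ => log_pureLam_ge' k
  have h2 : ∑ k ∈ range n, (1 / (4 * ((k : ℝ) + 2)) - (if k = 0 then 1 / 8 else 0)) ≥
      1 / 4 * ∑ k ∈ range n, 1 / ((k : ℝ) + 2) - 1 / 8 := by
    rw [sum_sub_distrib, mul_sum]
    have ha : ∑ k ∈ range n, 1 / (4 * ((k : ℝ) + 2)) = ∑ k ∈ range n, 1 / 4 * (1 / ((k : ℝ) + 2)) := by
      refine sum_congr rfl fun k _ => ?_
      have : ((k : ℝ) + 2) ≠ 0 := by positivity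
      field_simp
    have hb : ∑ k ∈ range n, (if k = 0 then (1 / 8 : ℝ) else 0) ≤ 1 / 8 := by
      rcases Nat.eq_zero_or_pos n with hn | hn
      · subst hn; simp
      · rw [sum_ite_eq' (range n) 0 (fun _ => (1 / 8 : ℝ))]
        simp [hn]
    rw [ha]
    linarith
  have h3 := log_sub_one_le_sum_inv n
  linarith

/-- **Growth of the pure determinant**: `∏_{k<n} λ_k ≥ e^{-3/8} (n+2)^{1/4}`. [folklore] -/
theorem prod_pureLam_ge (n : ℕ) :
    Real.exp (-(3 / 8)) * ((n : ℝ) + 2) ^ (1 / 4 : ℝ) ≤ ∏ k ∈ range n, pureLam k := by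
  have hpos : 0 < ∏ k ∈ range n, pureLam k :=
    prod_pos fun k _ => lt_of_lt_of_le one_pos (one_le_pureLam k)
  have h := log_prod_pureLam_ge n
  have hn : (0 : ℝ) < n + 2 := by positivity
  calc Real.exp (-(3 / 8)) * ((n : ℝ) + 2) ^ (1 / 4 : ℝ)
      = Real.exp ((Real.log (n + 2) - 3 / 2) / 4) := by
        rw [Real.rpow_def_of_pos hn, ← Real.exp_add]
        congr 1
        ring
    _ ≤ Real.exp (Real.log (∏ k ∈ range n, pureLam k)) := Real.exp_le_exp.2 h
    _ = ∏ k ∈ range n, pureLam k := Real.exp_log hpos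

end Wallis

/-! ### The pure symbol `|1 - e^{iθ}|` and its Toeplitz determinant -/

section PureDeterminant

/-- The pure Fisher–Hartwig symbol `|1 - e^{iθ}|` (one zero-type singularity, `α = ½`, `V ≡ 0`),
whose Toeplitz determinant is `E_{CUE(n)} |det(1 - U)|`.
[cite: DeiftItsKrasovsky2013, §6 (eq74), (eq78)] -/
def pureSymbol (θ : ℝ) : ℂ := ((‖1 - cexp (θ * I)‖ : ℝ) : ℂ)

/-- The pure symbol is continuous. [folklore] -/
theorem continuous_pureSymbol : Continuous pureSymbol := by
  unfold pureSymbol; fun_prop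

/-- The pure symbol is `2π`-periodic. [folklore] -/
theorem pureSymbol_periodic : Function.Periodic pureSymbol (2 * π) := by
  intro θ
  simp only [pureSymbol, cexp_add_two_pi_mul_I]

/-- On `[0, 2π]`: `|1 - e^{iθ}| = 2 sin(θ/2) = -i (e^{iθ/2} - e^{-iθ/2})`. [folklore] -/
theorem pureSymbol_eq_of_mem {θ : ℝ} (hθ : θ ∈ Set.Icc 0 (2 * π)) :
    pureSymbol θ = -I * (cexp (((θ / 2 : ℝ) : ℂ) * I) - cexp (-((θ / 2 : ℝ) : ℂ) * I)) := by
  have hsin : 0 ≤ Real.sin (θ / 2) :=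
    Real.sin_nonneg_of_nonneg_of_le_pi (by linarith [hθ.1]) (by linarith [hθ.2])
  rw [pureSymbol, norm_one_sub_cexp, abs_of_nonneg hsin]
  rw [show (((2 * Real.sin (θ / 2) : ℝ)) : ℂ) = 2 * Complex.sin ((θ / 2 : ℝ) : ℂ) by
    rw [Complex.ofReal_mul, Complex.ofReal_sin]; push_cast; ring]
  rw [Complex.sin]
  ring

/-- `1 - 4k² ≠ 0` for an integer `k`. [folklore] -/
theorem one_sub_four_mul_sq_ne_zero (k : ℤ) : (1 : ℝ) - 4 * (k : ℝ) ^ 2 ≠ 0 := by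
  intro h
  have h2 : (1 : ℤ) = 4 * k ^ 2 := by exact_mod_cast (by linarith : (1 : ℝ) = 4 * (k : ℝ) ^ 2)
  omega

/-- **The Fourier coefficients of `|1 - e^{iθ}|`**:
`(2π)⁻¹ ∫ e^{-ikθ} |1 - e^{iθ}| dθ = 4/(π(1 - 4k²))`
(`|sin(θ/2)| = 2/π - (4/π) ∑_{k≥1} cos(kθ)/(4k²-1)`). [folklore] -/
theorem circleCoeff_pureSymbol (k : ℤ) :
    circleCoeff pureSymbol k = ((4 / (π * (1 - 4 * (k : ℝ) ^ 2)) : ℝ) : ℂ) := by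
  set G : ℝ → ℂ := fun θ => cexp (-(k * θ * I)) * pureSymbol θ with hG
  have hGp : Function.Periodic G (2 * π) := by
    intro θ
    simp only [hG, pureSymbol_periodic θ]
    congr 1
    rw [show -((k : ℂ) * ((θ + 2 * π : ℝ) : ℂ) * I) = -(k * θ * I) + ((-k : ℤ) : ℂ) * (2 * π * I) by
      push_cast; ring, Complex.exp_add, Complex.exp_int_mul_two_pi_mul_I, mul_one]
  have hshift : ∫ θ in (-π)..π, G θ = ∫ θ in (0 : ℝ)..2 * π, G θ := by
    have h := hGp.intervalIntegral_add_eq (-π) 0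
    rw [show -π + 2 * π = π by ring, zero_add] at h
    exact h
  have hunfold : circleCoeff pureSymbol k = (2 * π : ℂ)⁻¹ * ∫ θ in (-π)..π, G θ := rfl
  rw [hunfold, hshift]
  -- the two exponents
  set c₁ : ℂ := (1 / 2 - (k : ℂ)) * I with hc₁
  set c₂ : ℂ := -(1 / 2 + (k : ℂ)) * I with hc₂
  have hk1 : (1 / 2 - (k : ℂ)) ≠ 0 := by
    intro h
    have h'' : (1 / 2 - (k : ℝ) : ℝ) = 0 := by
      have := congrArg Complex.re h
      simpa using this
    have : (1 : ℝ) = 2 * (k : ℝ) := by linarith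
    have : (1 : ℤ) = 2 * k := by exact_mod_cast this
    omega
  have hk2 : (1 / 2 + (k : ℂ)) ≠ 0 := by
    intro h
    have h'' : (1 / 2 + (k : ℝ) : ℝ) = 0 := by
      have := congrArg Complex.re h
      simpa using this
    have : (-1 : ℝ) = 2 * (k : ℝ) := by linarith
    have : (-1 : ℤ) = 2 * k := by exact_mod_cast this
    omega
  have hc₁0 : c₁ ≠ 0 := mul_ne_zero hk1 Complex.I_ne_zero
  have hc₂0 : c₂ ≠ 0 := mul_ne_zero (neg_ne_zero.2 hk2) Complex.I_ne_zero
  -- pointwise form of `G` on `[0, 2π]`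
  have hpt : Set.EqOn G (fun θ => -I * (cexp (c₁ * θ) - cexp (c₂ * θ))) (Set.uIcc 0 (2 * π)) := by
    intro θ hθ
    rw [Set.uIcc_of_le (by positivity)] at hθ
    have e1 : cexp (-(k * θ * I)) * cexp (((θ / 2 : ℝ) : ℂ) * I) = cexp (c₁ * θ) := by
      rw [← Complex.exp_add]
      congr 1
      rw [hc₁]; push_cast; ring
    have e2 : cexp (-(k * θ * I)) * cexp (-((θ / 2 : ℝ) : ℂ) * I) = cexp (c₂ * θ) := by
      rw [← Complex.exp_add]
      congr 1
      rw [hc₂]; push_cast; ring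
    simp only [hG]
    rw [pureSymbol_eq_of_mem hθ, ← e1, ← e2]
    ring
  rw [intervalIntegral.integral_congr hpt, intervalIntegral.integral_const_mul,
    intervalIntegral.integral_sub (Continuous.intervalIntegrable (by fun_prop) _ _)
      (Continuous.intervalIntegrable (by fun_prop) _ _),
    integral_exp_mul_complex hc₁0, integral_exp_mul_complex hc₂0]
  -- the endpoint exponentials
  have he1 : cexp (c₁ * ((2 * π : ℝ) : ℂ)) = -1 := by
    rw [show c₁ * ((2 * π : ℝ) : ℂ) = π * I + ((-k : ℤ) : ℂ) * (2 * π * I) by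
      rw [hc₁]; push_cast; ring, Complex.exp_add, Complex.exp_pi_mul_I,
      Complex.exp_int_mul_two_pi_mul_I, mul_one]
  have he2 : cexp (c₂ * ((2 * π : ℝ) : ℂ)) = -1 := by
    rw [show c₂ * ((2 * π : ℝ) : ℂ) = π * I + ((-k - 1 : ℤ) : ℂ) * (2 * π * I) by
      rw [hc₂]; push_cast; ring, Complex.exp_add, Complex.exp_pi_mul_I,
      Complex.exp_int_mul_two_pi_mul_I, mul_one]
  rw [he1, he2]
  simp only [Complex.ofReal_zero, mul_zero, Complex.exp_zero]
  -- algebra: `(2π)⁻¹ (-i) ((-2)/c₁ - (-2)/c₂) = 4/(π(1-4k²))`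
  have h14 : (1 / 4 - (k : ℂ) ^ 2) ≠ 0 := by
    have : (1 / 4 - (k : ℂ) ^ 2) = (1 / 2 - (k : ℂ)) * (1 / 2 + (k : ℂ)) := by ring
    rw [this]; exact mul_ne_zero hk1 hk2
  have hA : (-1 - 1) / c₁ - (-1 - 1) / c₂ = 2 * I / (1 / 4 - (k : ℂ) ^ 2) := by
    rw [div_sub_div _ _ hc₁0 hc₂0, div_eq_div_iff (mul_ne_zero hc₁0 hc₂0) h14, hc₁, hc₂]
    linear_combination (2 * I * (1 / 4 - (k : ℂ) ^ 2)) * Complex.I_sq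
  rw [hA]
  have hπ : (π : ℂ) ≠ 0 := by exact_mod_cast Real.pi_ne_zero
  have h14' : (1 - 4 * (k : ℂ) ^ 2) ≠ 0 := by
    have : (1 - 4 * (k : ℂ) ^ 2) = 4 * (1 / 4 - (k : ℂ) ^ 2) := by ring
    rw [this]; exact mul_ne_zero (by norm_num) h14
  push_cast
  rw [eq_div_iff (mul_ne_zero hπ h14')]
  field_simp
  linear_combination (-1 : ℂ) * Complex.I_sq

/-- **The pure Fisher–Hartwig determinant** `D_n(|1 - e^{iθ}|) = E_{CUE(n)}|det(1 - U)|`, a real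
number (`(2π)⁻ⁿ/n! ∫ ∏_i |1 - e^{iθ_i}| |Δ(θ)|² dθ`). [cite: DeiftItsKrasovsky2013, §6 (eq84)–(eq85) with m = 0, α₀ = ½] -/
def pureDet (n : ℕ) : ℝ := (toeplitzDet (circleCoeff pureSymbol) n).re

/-- The Toeplitz matrix of the pure symbol is the real moment matrix `(4/(π(1-4(j-k)²)))`.
[folklore] -/
theorem toeplitzMatrix_pureSymbol (n : ℕ) :
    toeplitzMatrix (circleCoeff pureSymbol) n = Complex.ofRealHom.mapMatrix (pureMatrix n) := by
  ext j k
  simp only [toeplitzMatrix_apply, circleCoeff_pureSymbol, RingHom.mapMatrix_apply, Matrix.map_apply,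
    pureMatrix, Matrix.of_apply, pureEntry, Complex.ofRealHom_eq_coe]

/-- The complex Toeplitz determinant of the pure symbol is the real determinant of the moment
matrix. [folklore] -/
theorem toeplitzDet_pureSymbol_eq (n : ℕ) :
    toeplitzDet (circleCoeff pureSymbol) n = ((pureMatrix n).det : ℂ) := by
  rw [toeplitzDet, toeplitzMatrix_pureSymbol, ← RingHom.map_det]
  rfl

/-- **Widom's pure case `α = ½` in closed form**:
`D_n(|1 - e^{iθ}|) = ∏_{k<n} λ_k = ∏_{k<n} (2/π)(2k)!!(2k+2)!!/((2k+1)!!)²`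
(`= G(n+1)G(n+2)G(3/2)²/(G(n+3/2)²G(2)) ∼ G(3/2)² n^{1/4}`).
[cite: DeiftItsKrasovsky2013, §6 (eq84)–(eq85) with m = 0] -/
theorem pureDet_eq_prod (n : ℕ) : pureDet n = ∏ k ∈ range n, pureLam k := by
  rw [pureDet, toeplitzDet_pureSymbol_eq, Complex.ofReal_re, det_pureMatrix]

/-- The complex Toeplitz determinant of the pure symbol is the real number `pureDet n`. [folklore] -/
theorem toeplitzDet_pureSymbol (n : ℕ) :
    toeplitzDet (circleCoeff pureSymbol) n = (pureDet n : ℂ) := by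
  rw [pureDet, toeplitzDet_pureSymbol_eq, Complex.ofReal_re]

/-- **Growth of the pure determinant**: `D_n(|1 - e^{iθ}|) ≥ e^{-3/8} (n+2)^{1/4}`. [folklore] -/
theorem pureDet_ge (n : ℕ) : Real.exp (-(3 / 8)) * ((n : ℝ) + 2) ^ (1 / 4 : ℝ) ≤ pureDet n := by
  rw [pureDet_eq_prod]; exact prod_pureLam_ge n

/-- `D_n(|1 - e^{iθ}|) > 0`. [folklore] -/
theorem pureDet_pos (n : ℕ) : 0 < pureDet n := by
  rw [pureDet_eq_prod]
  exact prod_pos fun k _ => lt_of_lt_of_le one_pos (one_le_pureLam k)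

end PureDeterminant

/-! ### The lower bound `c₀(n+1) ≥ D_n(|1 - e^{iθ}|)²` (Heine + Cauchy–Schwarz) -/

section LowerBound

variable {n : ℕ}

/-- `G_u(θ) = ∏_i |e^{iθ_i} - e^{iu}|`, the modulus of the characteristic polynomial of the
"eigenvalues" `e^{iθ_i}` at `e^{iu}`. [folklore] -/
def zeroFactor (n : ℕ) (u : ℝ) (θ : Fin n → ℝ) : ℝ := ∏ i, ‖cexp (θ i * I) - cexp (u * I)‖

/-- `G` is jointly continuous. [folklore] -/
theorem continuous_zeroFactor_uncurry (n : ℕ) :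
    Continuous (Function.uncurry (zeroFactor n)) := by
  change Continuous fun p : ℝ × (Fin n → ℝ) => ∏ i, ‖cexp (p.2 i * I) - cexp (p.1 * I)‖
  refine continuous_finsetProd _ fun i _ => ?_
  fun_prop

/-- `G_u` is continuous for fixed `u`. [folklore] -/
theorem continuous_zeroFactor (n : ℕ) (u : ℝ) : Continuous (zeroFactor n u) :=
  (continuous_zeroFactor_uncurry n).comp (Continuous.prodMk_right u)

/-- `0 ≤ G ≤ 2ⁿ`. [folklore] -/
theorem zeroFactor_nonneg (n : ℕ) (u : ℝ) (θ : Fin n → ℝ) : 0 ≤ zeroFactor n u θ :=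
  prod_nonneg fun _ _ => norm_nonneg _

/-- `G ≤ 2ⁿ`. [folklore] -/
theorem zeroFactor_le (n : ℕ) (u : ℝ) (θ : Fin n → ℝ) : zeroFactor n u θ ≤ 2 ^ n := by
  unfold zeroFactor
  calc ∏ i, ‖cexp (θ i * I) - cexp (u * I)‖ ≤ ∏ _i : Fin n, (2 : ℝ) := by
        refine prod_le_prod (fun _ _ => norm_nonneg _) fun i _ => ?_
        exact (norm_sub_le _ _).trans (by rw [norm_exp_ofReal_mul_I, norm_exp_ofReal_mul_I]; norm_num)
    _ = 2 ^ n := by simp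

/-- `|Δ(θ)| ≤ n!` (each of the `n!` Leibniz terms has modulus `1`). [folklore] -/
theorem norm_vandI_le (n : ℕ) (θ : Fin n → ℝ) : ‖vandI n θ‖ ≤ n.factorial := by
  rw [vandI_eq_sum]
  refine (norm_sum_le _ _).trans ?_
  have h : ∀ σ : Equiv.Perm (Fin n), ‖(Equiv.Perm.sign σ : ℂ) * ∏ i, expI (σ i) (θ i)‖ ≤ 1 := by
    intro σ
    rw [norm_mul, norm_prod]
    have h1 : ‖(Equiv.Perm.sign σ : ℂ)‖ = 1 := by
      rcases Int.units_eq_one_or (Equiv.Perm.sign σ) with h | h <;> simp [h]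
    have h2 : ∏ i, ‖expI (σ i) (θ i)‖ = 1 := prod_eq_one fun i _ => by
      rw [expI, show ((σ i : ℕ) : ℂ) * (θ i) * I = (((σ i : ℕ) * θ i : ℝ) : ℂ) * I by push_cast; ring]
      exact norm_exp_ofReal_mul_I _
    rw [h1, h2, one_mul]
  calc ∑ σ : Equiv.Perm (Fin n), ‖(Equiv.Perm.sign σ : ℂ) * ∏ i, expI (σ i) (θ i)‖
      ≤ ∑ _σ : Equiv.Perm (Fin n), (1 : ℝ) := sum_le_sum fun σ _ => h σ
    _ = n.factorial := by simp [Fintype.card_perm]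

/-- **Heine for Lenard's symbol, product form**: `R(n, u-s) (2π)ⁿ n! = ∫ G_u G_s |Δ|²`.
[folklore] -/
theorem lenardDet_mul_heineConst (u s : ℝ) :
    lenardDet n (u - s) * ((2 * π) ^ n * (n.factorial : ℝ)) =
      ∫ θ, zeroFactor n u θ * zeroFactor n s θ * ‖vandI n θ‖ ^ 2 ∂(torusMeasure n) := by
  have h := toeplitzDet_norm_symbol_mul_eq (continuous_lenardPoly u s) n
  rw [← lenardSymbol_eq_norm, toeplitzDet_lenardSymbol_eq_lenardDet, ← heineConst_cast,
    ← Complex.ofReal_mul] at h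
  have h' : lenardDet n (u - s) * ((2 * π) ^ n * (n.factorial : ℝ)) =
      ∫ θ, (∏ i, ‖lenardPoly u s (θ i)‖) * ‖vandI n θ‖ ^ 2 ∂(torusMeasure n) := by
    exact_mod_cast h
  rw [h']
  refine integral_congr_ae (Eventually.of_forall fun θ => ?_)
  simp only [lenardPoly, zeroFactor, norm_mul, prod_mul_distrib]

/-- **Heine for the pure symbol, rotated**: `D_n(|1 - e^{iθ}|) (2π)ⁿ n! = ∫ G_u |Δ|²` for every
`u` (rotation invariance). [folklore] -/
theorem pureDet_mul_heineConst (u : ℝ) :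
    pureDet n * ((2 * π) ^ n * (n.factorial : ℝ)) =
      ∫ θ, zeroFactor n u θ * ‖vandI n θ‖ ^ 2 ∂(torusMeasure n) := by
  set f : ℝ → ℂ := fun θ => cexp (θ * I) - cexp (u * I) with hf
  have hfc : Continuous f := by rw [hf]; fun_prop
  have hsym : (fun θ => ((‖f θ‖ : ℝ) : ℂ)) = fun θ => pureSymbol (θ - u) := by
    funext θ
    simp only [hf, pureSymbol]
    congr 1
    have : cexp (θ * I) - cexp (u * I) = -(cexp (u * I) * (1 - cexp (((θ - u : ℝ) : ℂ) * I))) := by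
      rw [mul_sub, mul_one, ← Complex.exp_add]
      push_cast
      ring_nf
    rw [this, norm_neg, norm_mul, norm_exp_ofReal_mul_I, one_mul]
  have h := toeplitzDet_norm_symbol_mul_eq hfc n
  rw [hsym, toeplitzDet_comp_sub pureSymbol_periodic u n, toeplitzDet_pureSymbol,
    ← heineConst_cast, ← Complex.ofReal_mul] at h
  have h' : pureDet n * ((2 * π) ^ n * (n.factorial : ℝ)) =
      ∫ θ, (∏ i, ‖f (θ i)‖) * ‖vandI n θ‖ ^ 2 ∂(torusMeasure n) := by exact_mod_cast h
  rw [h']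
  refine integral_congr_ae (Eventually.of_forall fun θ => ?_)
  simp only [hf, zeroFactor]

/-- **Heine for the constant symbol**: `(2π)ⁿ n! = ∫ |Δ|²` (`D_n(1) = 1`). [folklore] -/
theorem heineConst_eq_integral (n : ℕ) :
    ((2 * π) ^ n * (n.factorial : ℝ)) = ∫ θ, ‖vandI n θ‖ ^ 2 ∂(torusMeasure n) := by
  have h := toeplitzDet_norm_symbol_mul_eq (f := fun _ : ℝ => (1 : ℂ)) continuous_const n
  have hone : toeplitzDet (circleCoeff fun θ : ℝ => ((‖(1 : ℂ)‖ : ℝ) : ℂ)) n = 1 := by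
    have : (fun θ : ℝ => ((‖(1 : ℂ)‖ : ℝ) : ℂ)) = fun _ => (1 : ℂ) := by funext θ; simp
    rw [this, toeplitzDet]
    have hM : toeplitzMatrix (circleCoeff fun _ : ℝ => (1 : ℂ)) n = 1 := by
      ext j k
      simp only [toeplitzMatrix_apply, circleCoeff_const_fun, Matrix.one_apply, sub_eq_zero]
      by_cases hjk : j = k
      · subst hjk; simp
      · have : ((j : ℕ) : ℤ) ≠ k := by
          intro h; apply hjk; exact Fin.ext (by exact_mod_cast h)
        simp [hjk, this]
    rw [hM, det_one]
  rw [hone, one_mul, ← heineConst_cast] at h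
  have h' : ((2 * π) ^ n * (n.factorial : ℝ)) = ∫ θ, (∏ _i : Fin n, ‖(1 : ℂ)‖) * ‖vandI n θ‖ ^ 2
      ∂(torusMeasure n) := by exact_mod_cast h
  rw [h']
  simp

/-- Fubini between the angle `u ∈ [0, 2π]` and the torus, for a bounded continuous integrand.
[folklore] -/
theorem interval_torus_swap (f : ℝ → (Fin n → ℝ) → ℝ) (hf : Continuous (Function.uncurry f))
    {C : ℝ} (hC : ∀ u θ, |f u θ| ≤ C) :
    ∫ u in (0 : ℝ)..2 * π, ∫ θ, f u θ ∂(torusMeasure n) =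
      ∫ θ, (∫ u in (0 : ℝ)..2 * π, f u θ) ∂(torusMeasure n) := by
  refine MeasureTheory.intervalIntegral_integral_swap ?_
  rw [Set.uIoc_of_le (by positivity : (0 : ℝ) ≤ 2 * π)]
  refine Integrable.mono' (integrable_const C) hf.aestronglyMeasurable
    (Eventually.of_forall fun p => ?_)
  rw [Real.norm_eq_abs]
  exact hC p.1 p.2

/-- The circle average `M(θ) = ∫₀^{2π} G_u(θ) du` of the zero factor. [folklore] -/
def zeroFactorMean (n : ℕ) (θ : Fin n → ℝ) : ℝ := ∫ u in (0 : ℝ)..2 * π, zeroFactor n u θ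

/-- `M` is continuous. [folklore] -/
theorem continuous_zeroFactorMean (n : ℕ) : Continuous (zeroFactorMean n) := by
  unfold zeroFactorMean
  exact intervalIntegral.continuous_parametric_intervalIntegral_of_continuous (a₀ := 0)
    (by
      change Continuous fun p : (Fin n → ℝ) × ℝ => zeroFactor n p.2 p.1
      exact (continuous_zeroFactor_uncurry n).comp (continuous_snd.prodMk continuous_fst))
    continuous_const

/-- `0 ≤ M ≤ 2π 2ⁿ`. [folklore] -/
theorem abs_zeroFactorMean_le (n : ℕ) (θ : Fin n → ℝ) : |zeroFactorMean n θ| ≤ 2 * π * 2 ^ n := by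
  unfold zeroFactorMean
  have h := intervalIntegral.norm_integral_le_of_norm_le_const (a := (0 : ℝ)) (b := 2 * π)
    (f := fun u => zeroFactor n u θ) (C := 2 ^ n) fun u _ => by
      rw [Real.norm_of_nonneg (zeroFactor_nonneg n u θ)]; exact zeroFactor_le n u θ
  rw [sub_zero, abs_of_pos Real.two_pi_pos, Real.norm_eq_abs] at h
  linarith

/-- **First moment**: `2π D_n(|1-e^{iθ}|) (2π)ⁿn! = ∫ M |Δ|²`. [folklore] -/
theorem first_moment (n : ℕ) :
    2 * π * (pureDet n * ((2 * π) ^ n * (n.factorial : ℝ))) =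
      ∫ θ, zeroFactorMean n θ * ‖vandI n θ‖ ^ 2 ∂(torusMeasure n) := by
  have h1 : ∫ u in (0 : ℝ)..2 * π, pureDet n * ((2 * π) ^ n * (n.factorial : ℝ)) =
      2 * π * (pureDet n * ((2 * π) ^ n * (n.factorial : ℝ))) := by
    rw [intervalIntegral.integral_const, sub_zero, smul_eq_mul]
  rw [← h1]
  have h2 : ∫ u in (0 : ℝ)..2 * π, pureDet n * ((2 * π) ^ n * (n.factorial : ℝ)) =
      ∫ u in (0 : ℝ)..2 * π, ∫ θ, zeroFactor n u θ * ‖vandI n θ‖ ^ 2 ∂(torusMeasure n) :=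
    intervalIntegral.integral_congr fun u _ => pureDet_mul_heineConst u
  rw [h2, interval_torus_swap (fun u θ => zeroFactor n u θ * ‖vandI n θ‖ ^ 2)
    (by
      show Continuous fun p : ℝ × (Fin n → ℝ) => zeroFactor n p.1 p.2 * ‖vandI n p.2‖ ^ 2
      exact (continuous_zeroFactor_uncurry n).mul
        (((continuous_vandI n).comp continuous_snd).norm.pow 2))
    (C := 2 ^ n * (n.factorial : ℝ) ^ 2) fun u θ => ?_]
  · refine integral_congr_ae (Eventually.of_forall fun θ => ?_)
    simp only [zeroFactorMean]
    rw [intervalIntegral.integral_mul_const]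
  · rw [abs_of_nonneg (mul_nonneg (zeroFactor_nonneg n u θ) (sq_nonneg _))]
    have hv := norm_vandI_le n θ
    have hv0 := norm_nonneg (vandI n θ)
    calc zeroFactor n u θ * ‖vandI n θ‖ ^ 2 ≤ 2 ^ n * (n.factorial : ℝ) ^ 2 := by
          gcongr
          exact zeroFactor_le n u θ

/-- **Second moment**: `2π (∫₀^{2π} R(n,t) dt) (2π)ⁿn! = ∫ M² |Δ|²`. [folklore] -/
theorem second_moment (n : ℕ) :
    2 * π * ((∫ t in (0 : ℝ)..2 * π, lenardDet n t) * ((2 * π) ^ n * (n.factorial : ℝ))) =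
      ∫ θ, zeroFactorMean n θ ^ 2 * ‖vandI n θ‖ ^ 2 ∂(torusMeasure n) := by
  set K : ℝ := (2 * π) ^ n * (n.factorial : ℝ) with hK
  set I₀ : ℝ := ∫ t in (0 : ℝ)..2 * π, lenardDet n t with hI₀
  -- inner integral in `u`, for fixed `s`
  have hinner : ∀ s : ℝ, ∫ u in (0 : ℝ)..2 * π, lenardDet n (u - s) * K = I₀ * K := by
    intro s
    rw [intervalIntegral.integral_mul_const]
    congr 1
    rw [intervalIntegral.integral_comp_sub_right (fun t => lenardDet n t) s, zero_sub]
    have h := (lenardDet_periodic n).intervalIntegral_add_eq (-s) 0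
    rw [zero_add, show -s + 2 * π = 2 * π - s by ring] at h
    rw [h]
  have hLHS : ∫ s in (0 : ℝ)..2 * π, ∫ u in (0 : ℝ)..2 * π, lenardDet n (u - s) * K =
      2 * π * (I₀ * K) := by
    rw [intervalIntegral.integral_congr fun s _ => hinner s, intervalIntegral.integral_const,
      sub_zero, smul_eq_mul]
  rw [← hLHS]
  -- inner integral in `u` as a torus integral
  have hbound1 : ∀ s u θ, |zeroFactor n u θ * (zeroFactor n s θ * ‖vandI n θ‖ ^ 2)| ≤
      2 ^ n * (2 ^ n * (n.factorial : ℝ) ^ 2) := by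
    intro s u θ
    rw [abs_of_nonneg (mul_nonneg (zeroFactor_nonneg n u θ)
      (mul_nonneg (zeroFactor_nonneg n s θ) (sq_nonneg _)))]
    have hv := norm_vandI_le n θ
    have hv0 := norm_nonneg (vandI n θ)
    have := zeroFactor_le n u θ
    have := zeroFactor_le n s θ
    have := zeroFactor_nonneg n s θ
    gcongr
  have hstep1 : ∀ s : ℝ, ∫ u in (0 : ℝ)..2 * π, lenardDet n (u - s) * K =
      ∫ θ, zeroFactorMean n θ * zeroFactor n s θ * ‖vandI n θ‖ ^ 2 ∂(torusMeasure n) := by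
    intro s
    rw [intervalIntegral.integral_congr fun u _ => lenardDet_mul_heineConst u s]
    have hsw := interval_torus_swap (n := n)
      (fun u θ => zeroFactor n u θ * (zeroFactor n s θ * ‖vandI n θ‖ ^ 2))
      (by
        show Continuous fun p : ℝ × (Fin n → ℝ) =>
          zeroFactor n p.1 p.2 * (zeroFactor n s p.2 * ‖vandI n p.2‖ ^ 2)
        exact (continuous_zeroFactor_uncurry n).mul
          (((continuous_zeroFactor n s).comp continuous_snd).mul
            (((continuous_vandI n).comp continuous_snd).norm.pow 2)))
      (hbound1 s)
    have hrw : (fun u => ∫ θ, zeroFactor n u θ * zeroFactor n s θ * ‖vandI n θ‖ ^ 2 ∂(torusMeasure n)) =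
        fun u => ∫ θ, zeroFactor n u θ * (zeroFactor n s θ * ‖vandI n θ‖ ^ 2) ∂(torusMeasure n) := by
      funext u
      refine integral_congr_ae (Eventually.of_forall fun θ => ?_)
      simp only [mul_assoc]
    rw [show (∫ u in (0 : ℝ)..2 * π, ∫ θ, zeroFactor n u θ * zeroFactor n s θ * ‖vandI n θ‖ ^ 2
        ∂(torusMeasure n)) = ∫ u in (0 : ℝ)..2 * π, ∫ θ, zeroFactor n u θ *
          (zeroFactor n s θ * ‖vandI n θ‖ ^ 2) ∂(torusMeasure n) by rw [hrw], hsw]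
    refine integral_congr_ae (Eventually.of_forall fun θ => ?_)
    simp only [zeroFactorMean]
    rw [intervalIntegral.integral_mul_const]
    ring
  rw [intervalIntegral.integral_congr fun s _ => hstep1 s]
  -- swap `s` with the torus
  have hbound2 : ∀ s θ, |zeroFactorMean n θ * zeroFactor n s θ * ‖vandI n θ‖ ^ 2| ≤
      2 * π * 2 ^ n * 2 ^ n * (n.factorial : ℝ) ^ 2 := by
    intro s θ
    rw [abs_mul, abs_mul, abs_of_nonneg (zeroFactor_nonneg n s θ),
      abs_of_nonneg (sq_nonneg ‖vandI n θ‖)]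
    have hM := abs_zeroFactorMean_le n θ
    have hv := norm_vandI_le n θ
    have hv0 := norm_nonneg (vandI n θ)
    have := zeroFactor_le n s θ
    have := zeroFactor_nonneg n s θ
    have : 0 ≤ |zeroFactorMean n θ| := abs_nonneg _
    gcongr
  rw [interval_torus_swap (fun s θ => zeroFactorMean n θ * zeroFactor n s θ * ‖vandI n θ‖ ^ 2)
    (by
      show Continuous fun p : ℝ × (Fin n → ℝ) =>
        zeroFactorMean n p.2 * zeroFactor n p.1 p.2 * ‖vandI n p.2‖ ^ 2
      exact (((continuous_zeroFactorMean n).comp continuous_snd).mul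
        (continuous_zeroFactor_uncurry n)).mul
          (((continuous_vandI n).comp continuous_snd).norm.pow 2))
    hbound2]
  refine integral_congr_ae (Eventually.of_forall fun θ => ?_)
  simp only
  have : (fun s => zeroFactorMean n θ * zeroFactor n s θ * ‖vandI n θ‖ ^ 2) =
      fun s => zeroFactorMean n θ * ‖vandI n θ‖ ^ 2 * zeroFactor n s θ := by
    funext s; ring
  rw [this, intervalIntegral.integral_const_mul, zeroFactorMean]
  ring

/-- **Jensen / Cauchy–Schwarz on the torus**: `(∫ M |Δ|²)² ≤ (∫ M² |Δ|²) (∫ |Δ|²)`. [folklore] -/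
theorem first_moment_sq_le (n : ℕ) :
    (∫ θ, zeroFactorMean n θ * ‖vandI n θ‖ ^ 2 ∂(torusMeasure n)) ^ 2 ≤
      (∫ θ, zeroFactorMean n θ ^ 2 * ‖vandI n θ‖ ^ 2 ∂(torusMeasure n)) *
        ∫ θ, ‖vandI n θ‖ ^ 2 ∂(torusMeasure n) := by
  set V : (Fin n → ℝ) → ℝ := fun θ => ‖vandI n θ‖ ^ 2 with hV
  set M : (Fin n → ℝ) → ℝ := zeroFactorMean n with hM
  have hVc : Continuous V := ((continuous_vandI n).norm.pow 2)
  have hMc : Continuous M := continuous_zeroFactorMean n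
  have hint : ∀ {g : (Fin n → ℝ) → ℝ}, Continuous g → Integrable g (torusMeasure n) :=
    fun hg => memLp_one_iff_integrable.1 (memLp_torus_of_continuous hg 1)
  set A : ℝ := ∫ θ, M θ * V θ ∂(torusMeasure n)
  set B : ℝ := ∫ θ, M θ ^ 2 * V θ ∂(torusMeasure n)
  set K : ℝ := ∫ θ, V θ ∂(torusMeasure n)
  have hK0 : 0 ≤ K := integral_nonneg fun θ => sq_nonneg _
  -- `0 ≤ ∫ (a M - b)² V` for all real `a, b`: take `a = K`, `b = A`
  have hquad : ∀ a b : ℝ, 0 ≤ a ^ 2 * B - 2 * a * b * A + b ^ 2 * K := by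
    intro a b
    have h0 : 0 ≤ ∫ θ, (a * M θ - b) ^ 2 * V θ ∂(torusMeasure n) :=
      integral_nonneg fun θ => mul_nonneg (sq_nonneg _) (sq_nonneg _)
    have hexp : ∫ θ, (a * M θ - b) ^ 2 * V θ ∂(torusMeasure n) =
        a ^ 2 * B - 2 * a * b * A + b ^ 2 * K := by
      have e : (fun θ => (a * M θ - b) ^ 2 * V θ) =
          fun θ => a ^ 2 * (M θ ^ 2 * V θ) - 2 * a * b * (M θ * V θ) + b ^ 2 * V θ := by
        funext θ; ring
      rw [e, integral_add, integral_sub, integral_const_mul, integral_const_mul, integral_const_mul]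
      · exact (hint ((hMc.pow 2).mul hVc)).const_mul _
      · exact (hint (hMc.mul hVc)).const_mul _
      · exact ((hint ((hMc.pow 2).mul hVc)).const_mul _).sub ((hint (hMc.mul hVc)).const_mul _)
      · exact (hint hVc).const_mul _
    rw [hexp] at h0
    exact h0
  have h := hquad K A
  -- `K² B - 2 K A² + A² K ≥ 0`, i.e. `K (K B - A²) ≥ 0`
  rcases hK0.lt_or_eq with hKpos | hK0'
  · nlinarith [h, hKpos]
  · -- `K = 0`: then `A = 0` as well (`|M V| ≤ C V`)
    have hA0 : A = 0 := by
      have hle : |A| ≤ 2 * π * 2 ^ n * K := by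
        calc |A| ≤ ∫ θ, |M θ * V θ| ∂(torusMeasure n) := abs_integral_le_integral_abs
          _ ≤ ∫ θ, 2 * π * 2 ^ n * V θ ∂(torusMeasure n) := by
              refine integral_mono (hint (hMc.mul hVc)).abs ((hint hVc).const_mul _) fun θ => ?_
              have hV0 : 0 ≤ V θ := sq_nonneg _
              simp only
              rw [abs_mul, abs_of_nonneg hV0]
              exact mul_le_mul_of_nonneg_right (abs_zeroFactorMean_le n θ) hV0
          _ = 2 * π * 2 ^ n * K := integral_const_mul _ _
      rw [← hK0', mul_zero] at hle
      exact abs_nonpos_iff.1 hle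
    rw [hA0, ← hK0']
    simp

/-- **The lower bound**: `D_n(|1 - e^{iθ}|)² ≤ c₀(n+1)` — by Heine, rotation invariance and
Cauchy–Schwarz: `c₀(n+1) = E_{CUE(n)}[m²] ≥ (E[m])² = D_n(|1-z|)²`, `m` the circle average of
`|det(e^{iu} - U)|`. [folklore] -/
theorem pureDet_sq_le_zeroMomentumOccupation {L : ℝ} (hL : 0 < L) (n : ℕ) :
    pureDet n ^ 2 ≤ zeroMomentumOccupation (n + 1) L := by
  rw [zeroMomentumOccupation_succ_eq_integral hL n]
  set K : ℝ := (2 * π) ^ n * (n.factorial : ℝ) with hK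
  set I₀ : ℝ := ∫ t in (0 : ℝ)..2 * π, lenardDet n t with hI₀
  have hKpos : 0 < K := heineConst_pos n
  have h1 := first_moment n
  have h2 := second_moment n
  have h3 := heineConst_eq_integral n
  have hcs := first_moment_sq_le n
  rw [← h1, ← h2, ← h3] at hcs
  -- hcs : (2π D K)² ≤ (2π (I₀ K)) K
  have hπ := Real.pi_pos
  have h4 : 2 * π * pureDet n ^ 2 ≤ I₀ := by
    have : (2 * π) * (2 * π * pureDet n ^ 2) * K ^ 2 ≤ (2 * π) * I₀ * K ^ 2 := by nlinarith [hcs]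
    have hpos : 0 < (2 * π) * K ^ 2 := by positivity
    nlinarith [this, hpos]
  rw [hI₀] at h4
  calc pureDet n ^ 2 = (2 * π)⁻¹ * (2 * π * pureDet n ^ 2) := by field_simp
    _ ≤ (2 * π)⁻¹ * ∫ t in (0 : ℝ)..2 * π, lenardDet n t := by gcongr

/-- **The `√N` law, lower bound**: `c₀(N) ≥ e^{-3/4} √(N+1) > 0.47 √N` for every `N ≥ 1` and every
`L > 0` (Jensen `E[m²] ≥ E[m]²` and the exact pure determinant `E[m] = D_{N-1}(|1-z|) ≥
e^{-3/8}(N+1)^{1/4}`). [folklore] -/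
theorem sqrt_le_zeroMomentumOccupation {L : ℝ} (hL : 0 < L) (n : ℕ) :
    Real.exp (-(3 / 4)) * Real.sqrt (n + 2) ≤ zeroMomentumOccupation (n + 1) L := by
  have h := pureDet_sq_le_zeroMomentumOccupation hL n
  have hg := pureDet_ge n
  have hn : (0 : ℝ) ≤ n + 2 := by positivity
  have h0 : 0 ≤ Real.exp (-(3 / 8)) * ((n : ℝ) + 2) ^ (1 / 4 : ℝ) := by positivity
  calc Real.exp (-(3 / 4)) * Real.sqrt (n + 2)
      = (Real.exp (-(3 / 8)) * ((n : ℝ) + 2) ^ (1 / 4 : ℝ)) ^ 2 := by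
        rw [mul_pow, ← Real.exp_nat_mul, ← Real.rpow_natCast, ← Real.rpow_mul hn,
          Real.sqrt_eq_rpow]
        norm_num
    _ ≤ pureDet n ^ 2 := pow_le_pow_left₀ h0 hg 2
    _ ≤ zeroMomentumOccupation (n + 1) L := h

end LowerBound

/-! ### Antipodal zeros: decimation and Lenard's exact value `R(n, π) = D_{⌈n/2⌉}(|1-z|) D_{⌊n/2⌋}(|1-z|)` -/

section Antipodal


/-- The parity splitting `Fin ⌈n/2⌉ ⊕ Fin ⌊n/2⌋ ≃ Fin n`, `inl a ↦ 2a`, `inr b ↦ 2b + 1`. [folklore] -/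
def parityEquiv (n : ℕ) : Fin ((n + 1) / 2) ⊕ Fin (n / 2) ≃ Fin n where
  toFun x := match x with
    | Sum.inl a => ⟨2 * a, by omega⟩
    | Sum.inr b => ⟨2 * b + 1, by omega⟩
  invFun i := if h : (i : ℕ) % 2 = 0 then Sum.inl ⟨i / 2, by omega⟩ else Sum.inr ⟨i / 2, by omega⟩
  left_inv x := by
    rcases x with a | b
    · simp only
      rw [dif_pos (by omega)]
      congr 1
      apply Fin.ext
      simp only
      omega
    · simp only
      rw [dif_neg (by omega)]
      congr 1
      apply Fin.ext
      simp only
      omega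
  right_inv i := by
    by_cases h : (i : ℕ) % 2 = 0
    · simp only [h, dif_pos]
      apply Fin.ext
      simp only
      omega
    · simp only [h, dif_neg, not_false_eq_true]
      apply Fin.ext
      simp only
      omega

/-- The even positions. [folklore] -/
@[simp] theorem parityEquiv_inl (n : ℕ) (a : Fin ((n + 1) / 2)) :
    ((parityEquiv n (Sum.inl a) : Fin n) : ℕ) = 2 * a := rfl

/-- The odd positions. [folklore] -/
@[simp] theorem parityEquiv_inr (n : ℕ) (b : Fin (n / 2)) :
    ((parityEquiv n (Sum.inr b) : Fin n) : ℕ) = 2 * b + 1 := rfl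

/-- `2a - (2b+1)` is odd. [folklore] -/
theorem not_even_two_mul_sub (a b : ℤ) : ¬ Even (2 * a - (2 * b + 1)) := by
  rw [Int.not_even_iff_odd]
  exact ⟨a - b - 1, by ring⟩

/-- **Decimation of Toeplitz determinants**: if the coefficient sequence vanishes at odd indices,
`c_{2m} = d_m`, `c_{2m+1} = 0` (the symbol is `h(2θ)`), then `D_n(c) = D_{⌈n/2⌉}(d) D_{⌊n/2⌋}(d)`
(the Toeplitz matrix is block diagonal in the parity splitting).
[cite: Lenard1972, (42)–(43) (even/odd `n` for the antipodal symbol)] -/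
theorem toeplitzDet_decimate (d : ℤ → ℂ) (n : ℕ) :
    toeplitzDet (fun m => if Even m then d (m / 2) else 0) n =
      toeplitzDet d ((n + 1) / 2) * toeplitzDet d (n / 2) := by
  set c : ℤ → ℂ := fun m => if Even m then d (m / 2) else 0 with hc
  set e := parityEquiv n
  have hdet : toeplitzDet c n = ((toeplitzMatrix c n).submatrix e e).det := by
    rw [toeplitzDet, Matrix.det_submatrix_equiv_self]
  rw [hdet, ← Matrix.fromBlocks_toBlocks ((toeplitzMatrix c n).submatrix e e)]
  have h12 : ((toeplitzMatrix c n).submatrix e e).toBlocks₁₂ = 0 := by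
    ext a b
    simp only [toBlocks₁₂, of_apply, submatrix_apply, toeplitzMatrix_apply, Matrix.zero_apply, hc]
    simp only [e, parityEquiv_inl, parityEquiv_inr]
    push_cast
    rw [if_neg (not_even_two_mul_sub _ _)]
  have h21 : ((toeplitzMatrix c n).submatrix e e).toBlocks₂₁ = 0 := by
    ext b a
    simp only [toBlocks₂₁, of_apply, submatrix_apply, toeplitzMatrix_apply, Matrix.zero_apply, hc]
    simp only [e, parityEquiv_inl, parityEquiv_inr]
    push_cast
    rw [if_neg]
    intro h
    apply not_even_two_mul_sub (a : ℤ) (b : ℤ)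
    have : (2 * (a : ℤ) - (2 * (b : ℤ) + 1)) = -((2 * (b : ℤ) + 1) - 2 * (a : ℤ)) := by ring
    rw [this]
    exact h.neg
  have h11 : ((toeplitzMatrix c n).submatrix e e).toBlocks₁₁ = toeplitzMatrix d ((n + 1) / 2) := by
    ext a a'
    simp only [toBlocks₁₁, of_apply, submatrix_apply, toeplitzMatrix_apply, hc]
    simp only [e, parityEquiv_inl]
    push_cast
    rw [if_pos ⟨(a : ℤ) - a', by ring⟩]
    congr 1
    omega
  have h22 : ((toeplitzMatrix c n).submatrix e e).toBlocks₂₂ = toeplitzMatrix d (n / 2) := by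
    ext b b'
    simp only [toBlocks₂₂, of_apply, submatrix_apply, toeplitzMatrix_apply, hc]
    simp only [e, parityEquiv_inr]
    push_cast
    rw [if_pos ⟨(b : ℤ) - b', by ring⟩]
    congr 1
    omega
  rw [h12, h21, h11, h22, Matrix.det_fromBlocks_zero₁₂, toeplitzDet, toeplitzDet]

open Complex in
/-- **Fourier coefficients of a decimated symbol**: for a continuous `2π`-periodic `f`,
`(f(2·))_m = f_{m/2}` for even `m` and `0` for odd `m`. [folklore] -/
theorem circleCoeff_comp_two_mul {f : ℝ → ℂ} (hf : Continuous f)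
    (hper : Function.Periodic f (2 * Real.pi)) (m : ℤ) :
    circleCoeff (fun θ => f (2 * θ)) m = if Even m then circleCoeff f (m / 2) else 0 := by
  set H : ℝ → ℂ := fun u => cexp (-(m * u * I / 2)) * f u with hH
  have hHc : Continuous H := by rw [hH]; fun_prop
  -- Step 1: the coefficient as `(2π)⁻¹ ∫_{-π}^{π} H(2θ) dθ = (2π)⁻¹ 2⁻¹ ∫_{-2π}^{2π} H`
  have h1 : circleCoeff (fun θ => f (2 * θ)) m =
      (2 * Real.pi : ℂ)⁻¹ * ((2 : ℝ)⁻¹ • ∫ u in (2 * -Real.pi)..(2 * Real.pi), H u) := by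
    rw [circleCoeff, ← intervalIntegral.integral_comp_mul_left H two_ne_zero]
    congr 1
    refine intervalIntegral.integral_congr fun θ _ => ?_
    simp only [hH]
    congr 2
    push_cast
    ring
  -- Step 2: split at `0` and shift the left half by `2π`
  have hsplit : ∫ u in (2 * -Real.pi)..(2 * Real.pi), H u =
      (∫ u in (2 * -Real.pi)..0, H u) + ∫ u in (0 : ℝ)..2 * Real.pi, H u :=
    (intervalIntegral.integral_add_adjacent_intervals (hHc.intervalIntegrable _ _)
      (hHc.intervalIntegrable _ _)).symm
  set s : ℂ := cexp (m * Real.pi * I) with hs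
  have hshift : ∫ u in (2 * -Real.pi)..0, H u = s * ∫ u in (0 : ℝ)..2 * Real.pi, H u := by
    have h := intervalIntegral.integral_comp_sub_right H (2 * Real.pi) (a := 0) (b := 2 * Real.pi)
    rw [zero_sub, sub_self, show -(2 * Real.pi) = 2 * -Real.pi by ring] at h
    rw [← h, ← intervalIntegral.integral_const_mul]
    refine intervalIntegral.integral_congr fun u _ => ?_
    simp only [hH]
    rw [show u - 2 * Real.pi = u + -(2 * Real.pi) by ring, hper.neg u, ← mul_assoc, ← Complex.exp_add]
    congr 2
    push_cast
    ring
  -- Step 3: `∫_0^{2π} H` for even `m = 2k` is `2π f_k`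
  rcases Int.even_or_odd m with ⟨k, hk⟩ | ⟨k, hk⟩
  · have hk' : m = 2 * k := by rw [hk]; ring
    have hs1 : s = 1 := by
      rw [hs, hk']
      push_cast
      rw [show (2 : ℂ) * k * Real.pi * I = k * (2 * Real.pi * I) by ring]
      exact Complex.exp_int_mul_two_pi_mul_I k
    have hI : ∫ u in (0 : ℝ)..2 * Real.pi, H u = ∫ u in (-Real.pi)..Real.pi,
        cexp (-(k * u * I)) * f u := by
      have hG : H = fun u : ℝ => cexp (-(k * u * I)) * f u := by
        funext u; simp only [hH]; congr 2; rw [hk']; push_cast; ring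
      rw [hG]
      have hperG : Function.Periodic (fun u : ℝ => cexp (-(k * u * I)) * f u) (2 * Real.pi) := by
        intro u
        simp only [hper u]
        congr 1
        rw [show -((k : ℂ) * ((u + 2 * Real.pi : ℝ) : ℂ) * I) = -(k * u * I) + (-k : ℤ) * (2 * Real.pi * I)
          by push_cast; ring, Complex.exp_add, Complex.exp_int_mul_two_pi_mul_I, mul_one]
      have h := hperG.intervalIntegral_add_eq 0 (-Real.pi)
      rw [zero_add, show -Real.pi + 2 * Real.pi = Real.pi by ring] at h
      exact h
    rw [if_pos ⟨k, hk⟩, h1, hsplit, hshift, hs1, one_mul, hI, show m / 2 = k by omega, circleCoeff]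
    rw [Complex.real_smul]
    push_cast
    ring
  · have hodd : ¬ Even m := Int.not_even_iff_odd.2 ⟨k, hk⟩
    have hs1 : s = -1 := by
      rw [hs, hk]
      push_cast
      rw [show ((2 : ℂ) * k + 1) * Real.pi * I = k * (2 * Real.pi * I) + Real.pi * I by ring,
        Complex.exp_add, Complex.exp_int_mul_two_pi_mul_I, Complex.exp_pi_mul_I, one_mul]
    rw [if_neg hodd, h1, hsplit, hshift, hs1]
    simp


/-- Lenard's symbol with antipodal zeros is the decimated pure symbol:
`|e^{iθ} - e^{iπ}| |e^{iθ} - 1| = |1 - e^{2iθ}|`. [cite: Lenard1972, (31) with α = β = 1] -/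
theorem lenardSymbol_pi_zero (θ : ℝ) : lenardSymbol π 0 θ = pureSymbol (2 * θ) := by
  simp only [lenardSymbol, pureSymbol, Complex.ofReal_zero, zero_mul, Complex.exp_zero,
    Complex.exp_pi_mul_I]
  congr 1
  have : (cexp (θ * I) - -1) * (cexp (θ * I) - 1) = -(1 - cexp (((2 * θ : ℝ) : ℂ) * I)) := by
    rw [show ((2 * θ : ℝ) : ℂ) * I = θ * I + θ * I by push_cast; ring, Complex.exp_add]
    ring
  rw [this, norm_neg]

/-- **Lenard's exact value at antipodal zeros** (Szegő's suggestion, Lenard 1972): the Toeplitz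
determinant of `|e^{iθ} - 1||e^{iθ} + 1| = |1 - e^{2iθ}|` factorises by parity into two pure
Fisher–Hartwig determinants, `R(n, π) = D_{⌈n/2⌉}(|1 - e^{iθ}|) · D_{⌊n/2⌋}(|1 - e^{iθ}|)`
(`= ∏_{k<⌈n/2⌉} λ_k ∏_{k<⌊n/2⌋} λ_k`; this is Dyson's anchor `k_N = R_N(π)`).
[cite: Lenard1972, (42)–(46)] [cite: DeiftItsKrasovsky2013, Remark 8 (the evaluation of `R_N(π)`)] -/
theorem lenardDet_pi (n : ℕ) : lenardDet n π = pureDet ((n + 1) / 2) * pureDet (n / 2) := by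
  have hsym : lenardSymbol π 0 = fun θ => pureSymbol (2 * θ) := funext lenardSymbol_pi_zero
  have hcoef : circleCoeff (fun θ => pureSymbol (2 * θ)) =
      fun m => if Even m then circleCoeff pureSymbol (m / 2) else 0 :=
    funext fun m => circleCoeff_comp_two_mul continuous_pureSymbol pureSymbol_periodic m
  rw [lenardDet, hsym, hcoef, toeplitzDet_decimate, toeplitzDet_pureSymbol, toeplitzDet_pureSymbol,
    ← Complex.ofReal_mul, Complex.ofReal_re]

/-- Consequently `R(n, π)` grows like `√n`: `R(n, π) ≥ e^{-3/4} (⌈n/2⌉+2)^{1/4} (⌊n/2⌋+2)^{1/4}`.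
[folklore] -/
theorem lenardDet_pi_ge (n : ℕ) :
    Real.exp (-(3 / 4)) * ((((n + 1) / 2 : ℕ) : ℝ) + 2) ^ (1 / 4 : ℝ) *
      (((n / 2 : ℕ) : ℝ) + 2) ^ (1 / 4 : ℝ) ≤ lenardDet n π := by
  rw [lenardDet_pi]
  have h1 := pureDet_ge ((n + 1) / 2)
  have h2 := pureDet_ge (n / 2)
  have h0 : 0 ≤ Real.exp (-(3 / 8)) * ((((n + 1) / 2 : ℕ) : ℝ) + 2) ^ (1 / 4 : ℝ) := by positivity
  have h0' : 0 ≤ Real.exp (-(3 / 8)) * (((n / 2 : ℕ) : ℝ) + 2) ^ (1 / 4 : ℝ) := by positivity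
  calc Real.exp (-(3 / 4)) * ((((n + 1) / 2 : ℕ) : ℝ) + 2) ^ (1 / 4 : ℝ) *
        (((n / 2 : ℕ) : ℝ) + 2) ^ (1 / 4 : ℝ)
      = (Real.exp (-(3 / 8)) * ((((n + 1) / 2 : ℕ) : ℝ) + 2) ^ (1 / 4 : ℝ)) *
          (Real.exp (-(3 / 8)) * (((n / 2 : ℕ) : ℝ) + 2) ^ (1 / 4 : ℝ)) := by
        rw [show (-(3 / 4) : ℝ) = -(3 / 8) + -(3 / 8) by norm_num, Real.exp_add]
        ring
    _ ≤ pureDet ((n + 1) / 2) * pureDet (n / 2) := mul_le_mul h1 h2 h0' (pureDet_pos _).le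

end Antipodal

end Literature.Barriers.AtomisticToContinuum.BoseGas

namespace Literature.Barriers.AtomisticToContinuum

open BoseGas

/-- **The zero-momentum occupation of the Girardeau gas is of EXACT ORDER `√N`** (Szegő–Lenard
upper bound and the Jensen/pure-Fisher–Hartwig lower bound, both proved here):
`e^{-3/4} √(N+1) ≤ c₀(N) ≤ 4e √N` for every `N ≥ 1` and every `L > 0`
(printed: `c₀(N) ∼ 1.5427 √N`). [cite: DeiftItsKrasovsky2013, Remark 8]
[cite: ClaeysKrasovsky2015, §1 (Lrho0)–(LDy)] [cite: ForresterEtAl2003, §2.2.2] -/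
theorem oneDimensionalHardCore_sqrt_order (L : ℝ) (hL : 0 < L) (N : ℕ) (hN : 1 ≤ N) :
    Real.exp (-(3 / 4)) * Real.sqrt (N + 1) ≤ zeroMomentumOccupation N L ∧
      zeroMomentumOccupation N L ≤ 4 * Real.exp 1 * Real.sqrt N := by
  refine ⟨?_, zeroMomentumOccupation_le_sqrt N hL⟩
  obtain ⟨n, rfl⟩ : ∃ n, N = n + 1 := ⟨N - 1, by omega⟩
  have h := sqrt_le_zeroMomentumOccupation hL n
  push_cast
  rwa [show (n : ℝ) + 1 + 1 = n + 2 by ring]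

end Literature.Barriers.AtomisticToContinuum

end
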